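import Literature.Analysis.FluidPDE.JiaSverak2014DuhamelWithDatum
import Literature.Analysis.FluidPDE.JiaSverak2014PotentialsHolder
import Literature.Analysis.FluidPDE.JiaSverak2014CaloricHolder
import Literature.Analysis.FluidPDE.JiaSverak2014RepresentationData
import Literature.Analysis.FluidPDE.KatoLocalLerayPressure
import Literature.Analysis.FluidPDE.NSBoundedSpatialHolder
import Literature.Analysis.FluidPDE.LocalLerayDifferenceEnergy
import HarnessLib

/-!
# Jia–Šverák 2014, proof of Thm. 3.2: the Hölder continuous representative near the initial time

Analysis/FluidPDE proofs file (theorems only, no new definitions, no new named facts), part of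
the proof of the named fact `Literature.Analysis.FluidPDE.jia_sverak_2014_theorem_3_2`
(`JiaSverak2014LocalRegularity.lean`; H. Jia, V. Šverák, Invent. Math. 196 (2014) =
arXiv:1204.0529, §3 Thm. 3.2, proof p. 9). Given a local Leray solution `(u, p)` on
`(0,T') × ℝ³` which is essentially bounded by `K_b` on `(0,T_b⁺) × B(x₀, 7/12)` and whose datum is
bounded by `M` and `(M,γ)`-Hölderian on `B(x₀, 2)`, the localised Duhamel formula from the initial
time (`duhamel_representation_datum`, for the cut-off `φ = ζ(t)χ(x - x₀)` and the gauged pressure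
`p - c_{x₀}(t)` of Kang–Miura–Tsai's expansion at `(x₀, 7/24)`) exhibits, on `(0,T_b] × B(x₀,1/4)`
(where `φ ≡ 1`), each component of `u` as a sum of heat and gradient-multiplier potentials of
data supported in `s ≤ T_b` — bounded data built from `u` (`|u| ≤ K_b`), the far-field pressure
(`≲ α_u`) and the cut-off, and `L^∞_t L^q_x` data built from the near-field pressure
(Calderón–Zygmund) — plus the caloric extension of `χu₀`; by the quantitative Prop. 13.4
(`JiaSverak2014PotentialsHolder.lean`, exponents `d = 3 + γ`, `4 + γ`) and the Hölder continuity
of the caloric extension (`JiaSverak2014CaloricHolder.lean`) this sum is parabolic-Hölderian of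
exponent `γ` up to `t = 0`, with a constant depending only on `M, γ, K_b, α_u`; it is the
representative `U` (print: "`u = u₁ + u₂ + u₃` … In summary `u` is Hölder continuous in
`B̄_{1/4} × [0,T]`").

* `heatPotential_congr_of_lt`, `multiplierHeatPotential_congr_of_lt` — causality: the potentials
  at times `≤ T_b` only see the data below `T_b`;
* `holder_representative` — the statement above.

## References

* H. Jia, V. Šverák, Invent. Math. 196 (2014) = arXiv:1204.0529, §3, proof of Thm. 3.2 (p. 9).
  Bib key `JiaSverak2014`.
* P. G. Lemarié-Rieusset, *The Navier–Stokes Problem in the 21st Century* (2016), Prop. 13.4.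
  Bib key `LemarieRieusset2016`.
* K. Kang, H. Miura, T.-P. Tsai, IMRN 2021 = arXiv:1812.10509, Lemma 3.4. Bib key
  `KangMiuraTsai2020`.
-/

noncomputable section

open MeasureTheory TopologicalSpace Set Function Filter Metric
open _root_.Topology
open scoped ENNReal NNReal RealInnerProductSpace Laplacian

namespace Literature.Analysis.FluidPDE

namespace JiaSverak2014

open Literature.Analysis.UnboundedOperators LemarieRieusset2016

/-! ### Causality of the forward potentials -/

/-- **Causality of the heat potential**: if two data agree for `s < T_b`, their heat potentials
agree at every time `t ≤ T_b` (the forward kernel `W₊(t - s, ·)` vanishes for `s ≥ t`). [folklore] -/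
theorem heatPotential_congr_of_lt {ν Tb : ℝ} {D D' : ℝ × (EuclideanSpace ℝ (Fin 3)) → ℝ}
    (h : ∀ w : ℝ × EuclideanSpace ℝ (Fin 3), w.1 < Tb → D w = D' w)
    {z : ℝ × EuclideanSpace ℝ (Fin 3)} (hz : z.1 ≤ Tb) : heatPotential ν D z = heatPotential ν D' z := by
  simp only [heatPotential]
  refine integral_congr_ae (Eventually.of_forall fun w => ?_)
  by_cases hw : w.1 < Tb
  · simp only [h w hw]
  · have hk : heatKernelFwd ν (z - w) = 0 :=
      heatKernelFwd_of_nonpos ν (by simp only [Prod.fst_sub]; linarith [not_lt.1 hw])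
    simp only [hk, zero_smul]

/-- **Causality of the gradient-multiplier potential** (the kernel `σ(D)W₊(t - s, ·)` vanishes for
`s ≥ t`). [folklore] -/
theorem multiplierHeatPotential_congr_of_lt {ν Tb : ℝ} {σ : (EuclideanSpace ℝ (Fin 3)) → ℂ}
    {D D' : ℝ × (EuclideanSpace ℝ (Fin 3)) → ℝ}
    (h : ∀ w : ℝ × EuclideanSpace ℝ (Fin 3), w.1 < Tb → D w = D' w)
    {z : ℝ × EuclideanSpace ℝ (Fin 3)} (hz : z.1 ≤ Tb) :
    multiplierHeatPotential ν σ D z = multiplierHeatPotential ν σ D' z := by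
  simp only [multiplierHeatPotential]
  refine integral_congr_ae (Eventually.of_forall fun w => ?_)
  by_cases hw : w.1 < Tb
  · simp only [h w hw]
  · have hk : multiplierHeatKernelFwd ν σ (z - w) = 0 :=
      multiplierHeatKernelFwd_of_nonpos ν σ (by simp only [Prod.fst_sub]; linarith [not_lt.1 hw])
    simp only [hk, zero_mul]

/-- The heat potential of data vanishing for `s ≤ 0` vanishes at times `t ≤ 0`. [folklore] -/
theorem heatPotential_eq_zero_of_nonpos {ν : ℝ} {D : ℝ × (EuclideanSpace ℝ (Fin 3)) → ℝ}
    (h : ∀ w : ℝ × EuclideanSpace ℝ (Fin 3), w.1 ≤ 0 → D w = 0)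
    {z : ℝ × EuclideanSpace ℝ (Fin 3)} (hz : z.1 ≤ 0) : heatPotential ν D z = 0 := by
  have h' : ∀ w : ℝ × EuclideanSpace ℝ (Fin 3), w.1 < 0 → D w = (fun _ => (0 : ℝ)) w := fun w hw => h w hw.le
  rw [heatPotential_congr_of_lt h' hz]
  exact heatPotential_zero_fun ν z

/-- The gradient-multiplier potential of data vanishing for `s ≤ 0` vanishes at times `t ≤ 0`.
[folklore] -/
theorem multiplierHeatPotential_eq_zero_of_nonpos {ν : ℝ} {σ : (EuclideanSpace ℝ (Fin 3)) → ℂ}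
    {D : ℝ × (EuclideanSpace ℝ (Fin 3)) → ℝ}
    (h : ∀ w : ℝ × EuclideanSpace ℝ (Fin 3), w.1 ≤ 0 → D w = 0)
    {z : ℝ × EuclideanSpace ℝ (Fin 3)} (hz : z.1 ≤ 0) : multiplierHeatPotential ν σ D z = 0 := by
  have h' : ∀ w : ℝ × EuclideanSpace ℝ (Fin 3), w.1 < 0 → D w = (fun _ => (0 : ℝ)) w := fun w hw => h w hw.le
  rw [multiplierHeatPotential_congr_of_lt h' hz]
  exact multiplierHeatPotential_zero_fun ν σ z

/-! ### Small tools -/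

/-- The `L¹`-Morrey bound of a sum of two data is the sum of the bounds. [folklore] -/
theorem morreyOne_add {f g : ℝ × (EuclideanSpace ℝ (Fin 3)) → ℝ} {Bf Bg d : ℝ} (hBf : 0 ≤ Bf) (hBg : 0 ≤ Bg)
    (hf : AEMeasurable f volume)
    (hMf : ∀ (c : ℝ × (EuclideanSpace ℝ (Fin 3))) (r : ℝ), 0 < r →
      ∫⁻ w in FluidPDE.parabolicCylinderCentered r c, ‖f w‖ₑ ≤ ENNReal.ofReal (Bf * r ^ d))
    (hMg : ∀ (c : ℝ × (EuclideanSpace ℝ (Fin 3))) (r : ℝ), 0 < r →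
      ∫⁻ w in FluidPDE.parabolicCylinderCentered r c, ‖g w‖ₑ ≤ ENNReal.ofReal (Bg * r ^ d))
    (c : ℝ × (EuclideanSpace ℝ (Fin 3))) {r : ℝ} (hr : 0 < r) :
    ∫⁻ w in FluidPDE.parabolicCylinderCentered r c, ‖f w + g w‖ₑ ≤ ENNReal.ofReal ((Bf + Bg) * r ^ d) := by
  calc ∫⁻ w in FluidPDE.parabolicCylinderCentered r c, ‖f w + g w‖ₑ
      ≤ ∫⁻ w in FluidPDE.parabolicCylinderCentered r c, (‖f w‖ₑ + ‖g w‖ₑ) := lintegral_mono fun w => enorm_add_le _ _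
    _ = (∫⁻ w in FluidPDE.parabolicCylinderCentered r c, ‖f w‖ₑ) + ∫⁻ w in FluidPDE.parabolicCylinderCentered r c, ‖g w‖ₑ :=
        lintegral_add_left' hf.restrict.enorm _
    _ ≤ ENNReal.ofReal (Bf * r ^ d) + ENNReal.ofReal (Bg * r ^ d) := add_le_add (hMf c r hr) (hMg c r hr)
    _ = ENNReal.ofReal ((Bf + Bg) * r ^ d) := by
        rw [← ENNReal.ofReal_add (by positivity) (by positivity)]; congr 1; ring

/-- Components of a vector written in the standard basis: `(∑ⱼ aⱼ eⱼ)ₖ = aₖ`. [folklore] -/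
theorem sum_smul_basisFun_apply (a : Fin 3 → ℝ) (k : Fin 3) :
    (∑ j, a j • EuclideanSpace.basisFun (Fin 3) ℝ j) k = a k := by
  simp [Finset.sum_apply, EuclideanSpace.basisFun_apply, Pi.single_apply]

/-- A vector is the sum of its components times the standard basis vectors. [folklore] -/
theorem eq_sum_inner_smul_basisFun (x : EuclideanSpace ℝ (Fin 3)) :
    x = ∑ j, ⟪x, EuclideanSpace.basisFun (Fin 3) ℝ j⟫ • EuclideanSpace.basisFun (Fin 3) ℝ j := by
  conv_lhs => rw [← (EuclideanSpace.basisFun (Fin 3) ℝ).sum_repr' x]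
  refine Finset.sum_congr rfl fun j _ => ?_
  rw [real_inner_comm]

/-- **A fixed spatial cut-off**: a smooth `χ₀ : ℝ³ → [0,1]`, equal to `1` on `B̄(0, 13/50)`, with
`tsupport χ₀ ⊆ B̄(0, 7/25)`, gradient bounded by `D`, Laplacian bounded by `L`, and `D`-Lipschitz.
[folklore] -/
theorem exists_spaceCutoff :
    ∃ (χ₀ : (EuclideanSpace ℝ (Fin 3)) → ℝ) (D L : ℝ), 0 ≤ D ∧ 0 ≤ L ∧ ContDiff ℝ (⊤ : ℕ∞) χ₀ ∧
      (∀ x, 0 ≤ χ₀ x) ∧ (∀ x, χ₀ x ≤ 1) ∧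
      (∀ x ∈ closedBall (0 : EuclideanSpace ℝ (Fin 3)) (13 / 50), χ₀ x = 1) ∧
      tsupport χ₀ ⊆ closedBall (0 : EuclideanSpace ℝ (Fin 3)) (7 / 25) ∧
      (∀ x, ‖fderiv ℝ χ₀ x‖ ≤ D) ∧ (∀ x, |(Δ χ₀) x| ≤ L) ∧
      (∀ x y, |χ₀ x - χ₀ y| ≤ D * ‖x - y‖) := by
  let θ : ContDiffBump (0 : EuclideanSpace ℝ (Fin 3)) := ⟨13 / 50, 7 / 25, by norm_num, by norm_num⟩
  have hrIn : θ.rIn = 13 / 50 := rfl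
  have hrOut : θ.rOut = 7 / 25 := rfl
  have hχ : ContDiff ℝ (⊤ : ℕ∞) θ := θ.contDiff
  have hχc : HasCompactSupport (θ : (EuclideanSpace ℝ (Fin 3)) → ℝ) := θ.hasCompactSupport
  -- gradient bound
  have hDcont : Continuous fun x => fderiv ℝ (θ : (EuclideanSpace ℝ (Fin 3)) → ℝ) x := hχ.continuous_fderiv (by simp)
  have hDK : ∀ x ∉ tsupport (θ : (EuclideanSpace ℝ (Fin 3)) → ℝ), fderiv ℝ (θ : (EuclideanSpace ℝ (Fin 3)) → ℝ) x = 0 := fun x hx => by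
    have h0 : (θ : (EuclideanSpace ℝ (Fin 3)) → ℝ) =ᶠ[𝓝 x] fun _ => (0 : ℝ) := notMem_tsupport_iff_eventuallyEq.1 hx
    rw [h0.fderiv_eq, fderiv_fun_const]; rfl
  obtain ⟨D, hD⟩ := hDcont.bounded_above_of_compact_support (HasCompactSupport.intro hχc fun x hx => hDK x hx)
  -- Laplacian bound
  have hLcont : Continuous fun x => (Δ (θ : (EuclideanSpace ℝ (Fin 3)) → ℝ)) x := continuous_laplacian (hχ.of_le (by norm_cast))
  have hLK : ∀ x ∉ tsupport (θ : (EuclideanSpace ℝ (Fin 3)) → ℝ), (Δ (θ : (EuclideanSpace ℝ (Fin 3)) → ℝ)) x = 0 := fun x hx =>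
    laplacian_eq_zero_of_notMem_tsupport hx
  obtain ⟨L, hL⟩ := hLcont.bounded_above_of_compact_support (HasCompactSupport.intro hχc fun x hx => hLK x hx)
  have hD0 : 0 ≤ D := (norm_nonneg _).trans (hD 0)
  have hL0 : 0 ≤ L := (norm_nonneg _).trans (hL 0)
  refine ⟨θ, D, L, hD0, hL0, hχ, fun x => θ.nonneg, fun x => θ.le_one, ?_, ?_, hD, fun x => ?_, ?_⟩
  · intro x hx
    exact θ.one_of_mem_closedBall (by rwa [hrIn])
  · rw [θ.tsupport_eq, hrOut]
  · rw [← Real.norm_eq_abs]; exact hL x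
  · intro x y
    rw [← Real.norm_eq_abs]
    have h := Convex.norm_image_sub_le_of_norm_fderiv_le (f := (θ : (EuclideanSpace ℝ (Fin 3)) → ℝ))
      (fun z _ => (hχ.differentiable (by simp)).differentiableAt) (fun z _ => hD z) convex_univ (mem_univ y) (mem_univ x)
    simpa [mul_comm] using h

/-! ### The Hölder continuous representative -/

set_option maxHeartbeats 20000000 in
/-- **The Hölder continuous representative near the initial time** (Jia–Šverák 2014, proof of
Thm. 3.2, arXiv p. 9, made quantitative: module docstring). For `M`, `0 < γ < 1`, `K_b ≥ 0` and
`α_u` there is `C_U` such that: for every local Leray solution `(u, p)` on `(0,T') × ℝ³` with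
measurable datum `u₀`, times `0 < T_b < T_b⁺ ≤ T'`, `T_b ≤ 1`, with `|u₀| ≤ M` and `u₀`
`(M,γ)`-Hölderian on `B(x₀, 2)`, `|u| ≤ K_b` a.e. on `(0,T_b⁺) × B(x₀, 7/12)` and
`∫_{B(z,1)}|u(t)|² ≤ α_u` for a.e. `t`, there is `U : ℝ → ℝ³ → ℝ³` with `U = u` a.e. on
`(0,T_b) × B(x₀,1/4)`, `U(0,·) = u₀` on `B̄(x₀,1/4)`, `|U| ≤ C_U` and
`|U(t,x) - U(s,y)| ≤ C_U(|t-s|^{1/2} + |x-y|)^γ` on `[0,T_b] × B̄(x₀,1/4)`.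
[cite: JiaSverak2014, §3 proof of Thm. 3.2 (arXiv p. 9)] -/
theorem holder_representative (M γ : ℝ≥0) (hγ0 : 0 < (γ : ℝ)) (hγ1 : (γ : ℝ) < 1) {Kb : ℝ} (hKb : 0 ≤ Kb) (αu : ℝ≥0) :
    ∃ CU : ℝ, ∀ {T' : ℝ} {x₀ : EuclideanSpace ℝ (Fin 3)}
      {u₀ : (EuclideanSpace ℝ (Fin 3)) → (EuclideanSpace ℝ (Fin 3))}
      {u : ℝ → (EuclideanSpace ℝ (Fin 3)) → (EuclideanSpace ℝ (Fin 3))} {p : ℝ → (EuclideanSpace ℝ (Fin 3)) → ℝ}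
      {Tb Tb' : ℝ},
      AEStronglyMeasurable u₀ volume → IsLocalLeraySolutionOn T' 1 u₀ u p →
      0 < Tb → Tb < Tb' → Tb' ≤ T' → Tb ≤ 1 →
      (∀ x ∈ ball x₀ 2, ‖u₀ x‖ ≤ M) → HolderOnWith M γ u₀ (ball x₀ 2) →
      (∀ᵐ z ∂(volume.restrict (Ioo 0 Tb' ×ˢ ball x₀ (7 / 12))), ‖u z.1 z.2‖ ≤ Kb) →
      (∀ᵐ t ∂(volume.restrict (Ioo 0 T')), ∀ z : EuclideanSpace ℝ (Fin 3), ∫⁻ x in ball z 1, ‖u t x‖ₑ ^ 2 ≤ αu) →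
      ∃ U : ℝ → (EuclideanSpace ℝ (Fin 3)) → (EuclideanSpace ℝ (Fin 3)),
        uncurry U =ᵐ[volume.restrict (Ioo 0 Tb ×ˢ ball x₀ (1 / 4))] uncurry u ∧
        (∀ x ∈ closedBall x₀ (1 / 4), U 0 x = u₀ x) ∧
        (∀ z ∈ Icc 0 Tb ×ˢ closedBall x₀ (1 / 4), ‖uncurry U z‖ ≤ CU) ∧
        IsParabolicHolderOn (Icc 0 Tb ×ˢ closedBall x₀ (1 / 4)) (uncurry U) CU γ := by
  classical
  /- ## universal objects and constants -/
  set b : OrthonormalBasis (Fin 3) ℝ (EuclideanSpace ℝ (Fin 3)) := EuclideanSpace.basisFun (Fin 3) ℝ with hb_def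
  have hb1 : ∀ i, ‖b i‖ = 1 := fun i => b.orthonormal.1 i
  obtain ⟨χ₀, Dχ, Lχ, hD0, hL0, hχs, hχnn, hχle, hχone, hχsupp, hχD, hχL, hχLip⟩ := exists_spaceCutoff
  have hχ2 : ContDiff ℝ 2 χ₀ := hχs.of_le (by norm_cast)
  have hχzero : ∀ y, y ∉ closedBall (0 : EuclideanSpace ℝ (Fin 3)) (7 / 25) → χ₀ y = 0 := fun y hy =>
    image_eq_zero_of_notMem_tsupport fun h => hy (hχsupp h)
  have hχfzero : ∀ y, y ∉ closedBall (0 : EuclideanSpace ℝ (Fin 3)) (7 / 25) → fderiv ℝ χ₀ y = 0 := fun y hy => by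
    have h0 : χ₀ =ᶠ[𝓝 y] fun _ => (0 : ℝ) := notMem_tsupport_iff_eventuallyEq.1 fun h => hy (hχsupp h)
    rw [h0.fderiv_eq, fderiv_fun_const]; rfl
  have hχLzero : ∀ y, y ∉ closedBall (0 : EuclideanSpace ℝ (Fin 3)) (7 / 25) → (Δ χ₀) y = 0 := fun y hy =>
    laplacian_eq_zero_of_notMem_tsupport fun h => hy (hχsupp h)
  -- kernel constants
  set A₁ : ℝ := max (gaussConst 1 3) (heatRegConst 1) with hA₁
  have hAgex : ∀ i : Fin 3, ∃ A : ℝ, ∀ {g : ℝ × (EuclideanSpace ℝ (Fin 3)) → ℝ}, Measurable g →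
      ∀ {B d : ℝ}, 0 ≤ B → 4 < d → d < 5 →
      (∀ w : ℝ × (EuclideanSpace ℝ (Fin 3)), w.1 ≤ 0 → g w = 0) →
      (∀ (c : ℝ × (EuclideanSpace ℝ (Fin 3))) (r : ℝ), 0 < r →
        ∫⁻ w in FluidPDE.parabolicCylinderCentered r c, ‖g w‖ₑ ≤ ENNReal.ofReal (B * r ^ d)) →
      ParabolicHolderOnWith (kernelHolderConstFwd A B 4 d) (d - 4)
        (fun z => -(multiplierHeatPotential 1 (derivSymbol (b i)) g z).re) univ := fun i =>
    exists_multiplierHeatPotential_holder_of_morreyOne (b i)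
  choose Ag hAg using hAgex
  -- the Calderón–Zygmund exponent and constants
  have h1γ : 0 < 1 - (γ : ℝ) := by linarith
  set qr : ℝ := 3 / (1 - (γ : ℝ)) + 2 with hqr
  have hqr2 : 2 ≤ qr := by have : 0 ≤ 3 / (1 - (γ : ℝ)) := by positivity
                           rw [hqr]; linarith
  set q : ℝ≥0∞ := ENNReal.ofReal qr with hq
  have hq_real : q.toReal = qr := ENNReal.toReal_ofReal (by linarith)
  have hq1 : 1 < q := by
    rw [hq, ← ENNReal.ofReal_one]; exact (ENNReal.ofReal_lt_ofReal_iff (by linarith)).2 (by linarith)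
  have hqt : q < ⊤ := ENNReal.ofReal_lt_top
  obtain ⟨Cq, hCq⟩ := exists_eLpNorm_localPressureNear_le_of_bound hq1 hqt
  obtain ⟨Ffar, hFfart, hFfar⟩ := exists_enorm_localPressureFar_le_of_uloc (r := (7 / 24 : ℝ)) (by norm_num) (by norm_num)
  -- volumes
  set V₁ : ℝ := (volume (ball (0 : EuclideanSpace ℝ (Fin 3)) 1)).toReal with hV₁
  set VE : ℝ := (volume (Icc (0 : ℝ) 1 ×ˢ closedBall (0 : EuclideanSpace ℝ (Fin 3)) 1)).toReal with hVE
  set Vq : ℝ≥0∞ := volume (ball (0 : EuclideanSpace ℝ (Fin 3)) (7 / 12)) with hVq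
  have hVqt : Vq ≠ ⊤ := measure_ball_lt_top.ne
  set Vρ : ℝ := (volume (ball (0 : EuclideanSpace ℝ (Fin 3)) (7 / 24))).toReal with hVρ
  have hV₁0 : 0 ≤ V₁ := ENNReal.toReal_nonneg
  have hVE0 : 0 ≤ VE := ENNReal.toReal_nonneg
  have hVρ0 : 0 ≤ Vρ := ENNReal.toReal_nonneg
  -- the sizes of the pressure data
  set Pn : ℝ≥0∞ := (Cq : ℝ≥0∞) * (ENNReal.ofReal (Kb ^ 2) * Vq ^ (1 / q.toReal)) with hPn
  have hPnt : Pn ≠ ⊤ := by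
    simp only [hPn]
    exact ENNReal.mul_ne_top ENNReal.coe_ne_top (ENNReal.mul_ne_top ENNReal.ofReal_ne_top
      (ENNReal.rpow_ne_top_of_nonneg (by positivity) hVqt))
  set Fb : ℝ := (Ffar * (αu : ℝ≥0∞)).toReal with hFb
  have hFb0 : 0 ≤ Fb := ENNReal.toReal_nonneg
  have hFbt : Ffar * (αu : ℝ≥0∞) ≠ ⊤ := ENNReal.mul_ne_top hFfart ENNReal.coe_ne_top
  -- exponents
  set d₁ : ℝ := 3 + γ with hd₁
  set d₂ : ℝ := 4 + γ with hd₂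
  set e : ℝ := 1 - 1 / q.toReal with he
  have he0 : 0 ≤ e := by
    rw [he, hq_real, sub_nonneg, div_le_one (by linarith)]; linarith
  -- Morrey constants
  set Bof : ℝ → ℝ := fun N => N * (2 * V₁ + VE) with hBof
  have hBof0 : ∀ {N : ℝ}, 0 ≤ N → 0 ≤ Bof N := fun hN => by simp only [hBof]; positivity
  set BLq : ℝ → ℝ := fun P => 2 * P * V₁ ^ e + P * Vρ ^ e with hBLq
  have hBLq0 : ∀ {P : ℝ}, 0 ≤ P → 0 ≤ BLq P := fun hP => by simp only [hBLq]; positivity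
  set B₁ : ℝ := Bof (Lχ * Kb) with hB₁
  set B₂ : ℝ := Bof (2 * Dχ * Kb) with hB₂
  set B₃ : ℝ := Bof (Dχ * Kb ^ 2) with hB₃
  set B₄ : ℝ := Bof (Kb ^ 2) with hB₄
  set B₅ : ℝ := BLq ((ENNReal.ofReal Dχ * Pn).toReal) + Bof (Dχ * Fb) with hB₅
  set B₆ : ℝ := BLq Pn.toReal + Bof Fb with hB₆
  have hB₁0 : 0 ≤ B₁ := hBof0 (by positivity)
  have hB₂0 : 0 ≤ B₂ := hBof0 (by positivity)
  have hB₃0 : 0 ≤ B₃ := hBof0 (by positivity)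
  have hB₄0 : 0 ≤ B₄ := hBof0 (by positivity)
  have hB₅0 : 0 ≤ B₅ := add_nonneg (hBLq0 ENNReal.toReal_nonneg) (hBof0 (by positivity))
  have hB₆0 : 0 ≤ B₆ := add_nonneg (hBLq0 ENNReal.toReal_nonneg) (hBof0 hFb0)
  -- Hölder constants of the seven kinds of terms
  set H₁ : ℝ := |kernelHolderConst A₁ B₁ 3 d₁| with hH₁
  set H₂ : Fin 3 → ℝ := fun i => |kernelHolderConstFwd (Ag i) B₂ 4 d₂| with hH₂
  set H₃ : ℝ := |kernelHolderConst A₁ B₃ 3 d₁| with hH₃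
  set H₄ : Fin 3 → ℝ := fun i => |kernelHolderConstFwd (Ag i) B₄ 4 d₂| with hH₄
  set H₅ : ℝ := |kernelHolderConst A₁ B₅ 3 d₁| with hH₅
  set H₆ : Fin 3 → ℝ := fun k => |kernelHolderConstFwd (Ag k) B₆ 4 d₂| with hH₆
  set H₇ : ℝ := (2 + 2 * (2 : ℝ) ^ ((3 : ℝ) / 2)) * ((M : ℝ) * (1 + 4 * Dχ)) with hH₇
  have hH₇0 : 0 ≤ H₇ := by simp only [hH₇]; positivity
  set Ck : Fin 3 → ℝ := fun k => H₁ + ∑ i, H₂ i + ∑ _i : Fin 3, H₃ + ∑ i, H₄ i + H₅ + H₆ k + H₇ with hCk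
  have hCk0 : ∀ k, 0 ≤ Ck k := fun k => by
    simp only [hCk]
    refine add_nonneg (add_nonneg (add_nonneg (add_nonneg (add_nonneg (add_nonneg (abs_nonneg _)
      (Finset.sum_nonneg fun i _ => abs_nonneg _)) (Finset.sum_nonneg fun i _ => abs_nonneg _))
      (Finset.sum_nonneg fun i _ => abs_nonneg _)) (abs_nonneg _)) (abs_nonneg _)) hH₇0
  set CH : ℝ := ∑ k, Ck k with hCH
  have hCH0 : 0 ≤ CH := Finset.sum_nonneg fun k _ => hCk0 k
  refine ⟨CH + M, ?_⟩
  intro T' x₀ u₀ u p Tb Tb' hm₀ hu hTb hTbTb' hTb'T' hTb1 hM hH hbd hαu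
  have hTb' : 0 < Tb' := hTb.trans hTbTb'
  have hT' : 0 < T' := hTb'.trans_le hTb'T'
  /- ## the cut-offs -/
  set χ : (EuclideanSpace ℝ (Fin 3)) → ℝ := fun x => χ₀ (x - x₀) with hχdef
  set δ : ℝ := (Tb' - Tb) / 8 with hδ
  have hδ0 : 0 < δ := by rw [hδ]; linarith
  set ζ : ℝ → ℝ := fun t => timePlateau δ (Tb + 6 * δ) (t + 2 * δ) with hζ
  have hζ1 : ∀ t, 0 ≤ t → t ≤ Tb + 2 * δ → ζ t = 1 := fun t h0 h1 =>
    timePlateau_eq_one hδ0 (by linarith) (by linarith)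
  have hζhi : ∀ t, Tb + 3 * δ ≤ t → ζ t = 0 := fun t ht => timePlateau_eq_zero_of_ge hδ0 (by linarith)
  have hζlo : ∀ t, t ≤ -δ → ζ t = 0 := fun t ht => timePlateau_eq_zero_of_le hδ0 (by linarith)
  have hζnn : ∀ t, 0 ≤ ζ t := fun t => timePlateau_nonneg _ _ _
  have hζle : ∀ t, ζ t ≤ 1 := fun t => timePlateau_le_one _ _ _
  have hζs : ContDiff ℝ (⊤ : ℕ∞) ζ := (contDiff_timePlateau δ (Tb + 6 * δ)).comp (contDiff_id.add contDiff_const)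
  have hζd : ∀ t, 0 ≤ t → t ≤ Tb → deriv ζ t = 0 := fun t h0 h1 =>
    IsLocalMax.deriv_eq_zero (Eventually.of_forall fun s => by
      rw [hζ1 t h0 (by linarith)]; exact hζle s)
  set φ : ℝ → (EuclideanSpace ℝ (Fin 3)) → ℝ := fun t x => ζ t * χ x with hφ
  -- support and test-function property
  set Kφ : Set (ℝ × EuclideanSpace ℝ (Fin 3)) := Icc (-δ) (Tb + 3 * δ) ×ˢ closedBall x₀ (7 / 25) with hKφ
  have hKφc : IsCompact Kφ := isCompact_Icc.prod (isCompact_closedBall _ _)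
  have hφzero : ∀ z : ℝ × EuclideanSpace ℝ (Fin 3), z ∉ Kφ → uncurry φ z = 0 := by
    rintro ⟨t, x⟩ hz
    simp only [uncurry, hφ]
    by_cases hx : x ∈ closedBall x₀ (7 / 25)
    · have ht : t ∉ Icc (-δ) (Tb + 3 * δ) := fun h => hz ⟨h, hx⟩
      rw [mem_Icc, not_and_or, not_le, not_le] at ht
      rcases ht with h | h
      · rw [hζlo t h.le, zero_mul]
      · rw [hζhi t h.le, zero_mul]
    · have : χ x = 0 := by
        simp only [hχdef]
        refine hχzero _ fun h => hx ?_
        rw [mem_closedBall, dist_eq_norm]; simpa [mem_closedBall, dist_zero_right] using h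
      rw [this, mul_zero]
  have hφcs : HasCompactSupport (uncurry φ) := HasCompactSupport.intro hKφc hφzero
  have hφtsupp : tsupport (uncurry φ) ⊆ Kφ :=
    closure_minimal (fun z hz => by by_contra h; exact hz (hφzero z h)) (hKφc.isClosed)
  have hφT : IsSpaceTimeTestOn (slab (EuclideanSpace ℝ (Fin 3)) (Iio Tb') isOpen_Iio) φ := by
    refine ⟨?_, hφcs, fun z hz => mem_slab.2 ?_⟩
    · have : uncurry φ = fun z : ℝ × EuclideanSpace ℝ (Fin 3) => ζ z.1 * χ₀ (z.2 - x₀) := rfl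
      rw [this]
      exact (hζs.comp contDiff_fst).mul (hχs.comp (contDiff_snd.sub contDiff_const))
    · have h := (hφtsupp hz).1
      rw [mem_Iio]; rw [mem_Icc] at h; linarith [h.2]
  have hφ0 : ∀ x, φ 0 x = χ x := fun x => by simp only [hφ, hζ1 0 le_rfl (by positivity), one_mul]
  have hφ1 : ∀ (t : ℝ) (x : EuclideanSpace ℝ (Fin 3)), 0 ≤ t → t ≤ Tb → x ∈ closedBall x₀ (13 / 50) → φ t x = 1 := by
    intro t x h0 h1 hx
    simp only [hφ, hζ1 t h0 (by linarith), one_mul, hχdef]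
    exact hχone _ (by rw [mem_closedBall, dist_zero_right, ← dist_eq_norm]; exact hx)
  -- derivative formulas
  have hφfd : ∀ (t : ℝ) (x v : EuclideanSpace ℝ (Fin 3)), fderiv ℝ (φ t) x v = ζ t * fderiv ℝ χ₀ (x - x₀) v := by
    intro t x v
    have hdχ : DifferentiableAt ℝ χ x := ((hχs.comp (contDiff_id.sub contDiff_const)).differentiable (by simp)) x
    have e1 : (φ t) = fun y => ζ t * χ y := rfl
    rw [e1, fderiv_const_mul hdχ]
    have e2 : fderiv ℝ χ x = fderiv ℝ χ₀ (x - x₀) := by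
      simp only [hχdef, sub_eq_add_neg, fderiv_comp_add_right]
    simp [e2]
  have hφΔ : ∀ (t : ℝ) (x : EuclideanSpace ℝ (Fin 3)), (Δ (φ t)) x = ζ t * (Δ χ₀) (x - x₀) := by
    intro t x
    have e1 : (φ t) = fun y => ζ t • χ y := by funext y; simp only [hφ, smul_eq_mul]
    have hχ2' : ContDiff ℝ 2 χ := hχ2.comp (contDiff_id.sub contDiff_const)
    rw [e1, laplacian_fun_const_smul hχ2' (ζ t) x, smul_eq_mul]
    congr 1
    exact laplacian_translate_sub χ₀ x₀ x
  have hφdt : ∀ (t : ℝ) (x : EuclideanSpace ℝ (Fin 3)), timeDeriv φ t x = deriv ζ t * χ x := by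
    intro t x
    rw [timeDeriv_apply]
    show deriv (fun s => ζ s * χ x) t = deriv ζ t * χ x
    exact deriv_mul_const_field _
  /- ## the slab, the gauge and the weak form -/
  set S : Set (ℝ × EuclideanSpace ℝ (Fin 3)) := Ioo 0 Tb' ×ˢ (univ : Set (EuclideanSpace ℝ (Fin 3))) with hS
  have hSm : MeasurableSet S := measurableSet_Ioo.prod MeasurableSet.univ
  set S' : Set (ℝ × EuclideanSpace ℝ (Fin 3)) := Ioo 0 T' ×ˢ (univ : Set (EuclideanSpace ℝ (Fin 3))) with hS'
  have hS'm : MeasurableSet S' := measurableSet_Ioo.prod MeasurableSet.univ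
  have hSS' : S ⊆ S' := Set.prod_mono (Ioo_subset_Ioo_right hTb'T') Subset.rfl
  obtain ⟨cg, hcg, hdec⟩ := hu.exists_pressure_decomposition x₀ (r := (7 / 24 : ℝ)) (by norm_num)
  have hweak : ∀ ψ : ℝ → (EuclideanSpace ℝ (Fin 3)) → (EuclideanSpace ℝ (Fin 3)),
      IsSpaceTimeTestOn (slab (EuclideanSpace ℝ (Fin 3)) (Iio Tb') isOpen_Iio) ψ →
      (∫ t in Ioo 0 Tb', ∫ x, (⟪u t x, timeDeriv ψ t x⟫ + ⟪u t x, convect (u t) (ψ t) x⟫ +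
          1 * ⟪u t x, Δ (ψ t) x⟫ + (fun t x => p t x - cg t) t x * VectorCalculus.divergence (ψ t) x)) +
        ∫ x, ⟪u₀ x, ψ 0 x⟫ = 0 := fun ψ hψ =>
    hu.weakIdentity_datum_gauge hm₀ hTb' hTb'T' hcg hψ
  /- ## the modified velocity -/
  have hmeasS' : AEStronglyMeasurable (uncurry u) (volume.restrict S') := hu.aestronglyMeasurable
  set uM : ℝ × EuclideanSpace ℝ (Fin 3) → EuclideanSpace ℝ (Fin 3) := hmeasS'.mk (uncurry u) with huM
  have huMm : Measurable uM := hmeasS'.stronglyMeasurable_mk.measurable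
  have huMae : ∀ᵐ z ∂(volume : Measure (ℝ × EuclideanSpace ℝ (Fin 3))), z ∈ S' → uncurry u z = uM z :=
    (ae_restrict_iff' hS'm).1 hmeasS'.ae_eq_mk
  set us : ℝ × EuclideanSpace ℝ (Fin 3) → EuclideanSpace ℝ (Fin 3) := S.indicator uM with hus_def
  have husm : Measurable us := huMm.indicator hSm
  have hus : ∀ᵐ z ∂(volume : Measure (ℝ × EuclideanSpace ℝ (Fin 3))), z ∈ S → us z = u z.1 z.2 := by
    filter_upwards [huMae] with z hz hzS
    rw [hus_def, indicator_of_mem hzS, ← hz (hSS' hzS)]; rfl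
  have hus0 : ∀ z, z ∉ S → us z = 0 := fun z hz => indicator_of_notMem hz _
  -- integrability on finite cylinders
  have hu'' : IsLocalLeraySolutionOn Tb' 1 u₀ u p := hu.mono hTb'T'
  have hcyl : ∀ K : Set (EuclideanSpace ℝ (Fin 3)), IsCompact K →
      IntegrableOn uM (Ioo 0 Tb' ×ˢ K) volume ∧ IntegrableOn (fun z => ‖uM z‖ ^ 2) (Ioo 0 Tb' ×ˢ K) volume := by
    intro K hK
    obtain ⟨h1, h2⟩ := integrableOn_cylinder_of_lintegral_sq_slab hu''.aestronglyMeasurable (fun K hK => hu''.sqIntegrable K hK) hK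
    have hae : ∀ᵐ z ∂(volume.restrict (Ioo 0 Tb' ×ˢ K)), uncurry u z = uM z := by
      rw [ae_restrict_iff' (measurableSet_Ioo.prod hK.measurableSet)]
      filter_upwards [huMae] with z hz hzK
      exact hz (hSS' ⟨hzK.1, mem_univ _⟩)
    exact ⟨h1.congr_fun_ae hae, h2.congr_fun_ae (hae.mono fun z hz => by simp only [hz])⟩
  have husi : LocallyIntegrable us volume := by
    rw [locallyIntegrable_iff]
    intro K hK
    rw [hus_def, integrableOn_indicator_iff hSm]
    set Kx : Set (EuclideanSpace ℝ (Fin 3)) := Prod.snd '' K with hKx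
    have hKxc : IsCompact Kx := hK.image continuous_snd
    refine ((hcyl Kx hKxc).1).mono_set ?_
    rintro z ⟨hzS, hzK⟩
    exact ⟨hzS.1, ⟨z, hzK, rfl⟩⟩
  have hus2 : LocallyIntegrable (fun z => ‖us z‖ ^ 2) volume := by
    have e1 : (fun z => ‖us z‖ ^ 2) = S.indicator (fun z => ‖uM z‖ ^ 2) := by
      funext z
      by_cases hz : z ∈ S
      · simp only [hus_def, indicator_of_mem hz]
      · simp only [hus_def, indicator_of_notMem hz, norm_zero]; norm_num
    rw [e1, locallyIntegrable_iff]
    intro K hK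
    rw [integrableOn_indicator_iff hSm]
    set Kx : Set (EuclideanSpace ℝ (Fin 3)) := Prod.snd '' K with hKx
    have hKxc : IsCompact Kx := hK.image continuous_snd
    refine ((hcyl Kx hKxc).2).mono_set ?_
    rintro z ⟨hzS, hzK⟩
    exact ⟨hzS.1, ⟨z, hzK, rfl⟩⟩
  -- the velocity bound transferred to `us`
  have husb : ∀ᵐ z ∂(volume : Measure (ℝ × EuclideanSpace ℝ (Fin 3))),
      z ∈ S → z.2 ∈ ball x₀ (7 / 12) → ‖us z‖ ≤ Kb := by
    have h1 : ∀ᵐ z ∂(volume : Measure (ℝ × EuclideanSpace ℝ (Fin 3))), z ∈ Ioo 0 Tb' ×ˢ ball x₀ (7 / 12) → ‖u z.1 z.2‖ ≤ Kb :=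
      (ae_restrict_iff' (measurableSet_Ioo.prod measurableSet_ball)).1 hbd
    filter_upwards [h1, hus] with z hz hzu hzS hzB
    rw [hzu hzS]; exact hz ⟨hzS.1, hzB⟩
  
  /- ## the modified gauged pressure -/
  set pt : ℝ × EuclideanSpace ℝ (Fin 3) → ℝ := fun z => p z.1 z.2 - cg z.1 with hpt
  have hNae := hu.aestronglyMeasurable_localPressureNear x₀ (7 / 24 : ℝ)
  have hFae := hu.aestronglyMeasurable_localPressureFar x₀ (7 / 24 : ℝ)
  rw [← volume_restrict_slab_eq] at hNae hFae
  set nearM : ℝ × EuclideanSpace ℝ (Fin 3) → ℝ := hNae.mk _ with hnearM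
  set farM : ℝ × EuclideanSpace ℝ (Fin 3) → ℝ := hFae.mk _ with hfarM
  have hnearMm : Measurable nearM := hNae.stronglyMeasurable_mk.measurable
  have hfarMm : Measurable farM := hFae.stronglyMeasurable_mk.measurable
  have hnearae : ∀ᵐ z ∂(volume : Measure (ℝ × EuclideanSpace ℝ (Fin 3))), z ∈ S' →
      localPressureNear x₀ (7 / 24) u z.1 z.2 = nearM z := (ae_restrict_iff' hS'm).1 hNae.ae_eq_mk
  have hfarae : ∀ᵐ z ∂(volume : Measure (ℝ × EuclideanSpace ℝ (Fin 3))), z ∈ S' →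
      localPressureFar x₀ (7 / 24) u z.1 z.2 = farM z := (ae_restrict_iff' hS'm).1 hFae.ae_eq_mk
  have hdecae : ∀ᵐ z ∂(volume : Measure (ℝ × EuclideanSpace ℝ (Fin 3))), z ∈ Ioo 0 T' ×ˢ ball x₀ (7 / 24) →
      p z.1 z.2 = localPressureNear x₀ (7 / 24) u z.1 z.2 + localPressureFar x₀ (7 / 24) u z.1 z.2 + cg z.1 :=
    (ae_restrict_iff' (measurableSet_Ioo.prod measurableSet_ball)).1 hdec
  set psB : ℝ × EuclideanSpace ℝ (Fin 3) → ℝ := S.indicator fun z => nearM z + farM z with hpsB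
  set ps : ℝ × EuclideanSpace ℝ (Fin 3) → ℝ := fun z =>
    if z.2 ∈ ball x₀ (7 / 24) then psB z else S.indicator pt z with hps_def
  have hps : ∀ᵐ z ∂(volume : Measure (ℝ × EuclideanSpace ℝ (Fin 3))), z ∈ S → ps z = (fun t x => p t x - cg t) z.1 z.2 := by
    filter_upwards [hnearae, hfarae, hdecae] with z hzn hzf hzd hzS
    show ps z = p z.1 z.2 - cg z.1
    by_cases hzB : z.2 ∈ ball x₀ (7 / 24)
    · simp only [hps_def, hzB, if_true, hpsB, indicator_of_mem hzS]
      rw [← hzn (hSS' hzS), ← hzf (hSS' hzS), hzd ⟨(hSS' hzS).1, hzB⟩]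
      ring
    · simp only [hps_def, hzB, if_false, indicator_of_mem hzS, hpt]
  have hps0 : ∀ z, z ∉ S → ps z = 0 := fun z hz => by
    by_cases hzB : z.2 ∈ ball x₀ (7 / 24)
    · simp only [hps_def, hzB, if_true, hpsB, indicator_of_notMem hz]
    · simp only [hps_def, hzB, if_false, indicator_of_notMem hz]
  -- integrability of the gauged pressure on finite cylinders
  have hptK : ∀ K : Set (EuclideanSpace ℝ (Fin 3)), IsCompact K → IntegrableOn pt (Ioo 0 Tb' ×ˢ K) volume := by
    intro K hK
    haveI : IsFiniteMeasure ((volume : Measure (ℝ × (EuclideanSpace ℝ (Fin 3)))).restrict (Ioo 0 Tb' ×ˢ K)) :=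
      ⟨by rw [Measure.restrict_apply_univ]; exact volume_Ioo_prod_lt_top hK⟩
    have hsub : Ioo 0 Tb' ×ˢ K ⊆ ((slab (EuclideanSpace ℝ (Fin 3)) (Ioo 0 Tb') isOpen_Ioo :
        Opens (ℝ × (EuclideanSpace ℝ (Fin 3)))) : Set (ℝ × (EuclideanSpace ℝ (Fin 3)))) :=
      fun z hz => mem_slab.2 hz.1
    have hp1 : IntegrableOn (uncurry p) (Ioo 0 Tb' ×ˢ K) volume := by
      have hm : AEStronglyMeasurable (uncurry p) ((volume : Measure (ℝ × (EuclideanSpace ℝ (Fin 3)))).restrict (Ioo 0 Tb' ×ˢ K)) :=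
        (hu''.suitable.distributional.2.2.1.mono_set hsub).aestronglyMeasurable
      exact BradshawTsai2019.integrable_of_lintegral_rpow_enorm_lt_top hm (by norm_num : (1 : ℝ) ≤ 3 / 2) (hu''.pressure K hK)
    have hc1 : IntegrableOn (fun z : ℝ × (EuclideanSpace ℝ (Fin 3)) => cg z.1) (Ioo 0 Tb' ×ˢ K) volume := by
      haveI : IsFiniteMeasure ((volume : Measure ℝ).restrict (Ioo 0 Tb')) := ⟨by
        rw [Measure.restrict_apply_univ]; exact measure_Ioo_lt_top⟩
      have h32 : (1 : ℝ≥0∞) ≤ 3 / 2 :=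
        ((ENNReal.lt_div_iff_mul_lt (Or.inl two_ne_zero) (Or.inl ENNReal.ofNat_ne_top)).2 (by norm_num)).le
      have hcT : MemLp cg (3 / 2 : ℝ≥0∞) (volume.restrict (Ioo 0 Tb')) :=
        hcg.mono_measure (Measure.restrict_mono (Ioo_subset_Ioo_right hTb'T') le_rfl)
      have hci : Integrable cg ((volume : Measure ℝ).restrict (Ioo 0 Tb')) := hcT.integrable h32
      haveI : IsFiniteMeasure ((volume : Measure (EuclideanSpace ℝ (Fin 3))).restrict K) :=
        ⟨by rw [Measure.restrict_apply_univ]; exact hK.measure_lt_top⟩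
      have h1 : Integrable (fun _ : EuclideanSpace ℝ (Fin 3) => (1 : ℝ)) ((volume : Measure (EuclideanSpace ℝ (Fin 3))).restrict K) :=
        integrable_const _
      have h := hci.mul_prod h1
      rw [IntegrableOn, Measure.volume_eq_prod, ← Measure.prod_restrict]
      simpa using h
    have h : IntegrableOn (fun z => uncurry p z - cg z.1) (Ioo 0 Tb' ×ˢ K) volume := hp1.sub hc1
    exact h
  have hpsi : LocallyIntegrable ps volume := by
    have hL : LocallyIntegrable (S.indicator pt) volume := by
      rw [locallyIntegrable_iff]
      intro K hK
      rw [integrableOn_indicator_iff hSm]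
      set Kx : Set (EuclideanSpace ℝ (Fin 3)) := Prod.snd '' K with hKx
      have hKxc : IsCompact Kx := hK.image continuous_snd
      refine (hptK Kx hKxc).mono_set ?_
      rintro z ⟨hzS, hzK⟩
      exact ⟨hzS.1, ⟨z, hzK, rfl⟩⟩
    refine hL.congr ?_
    filter_upwards [hps] with z hz
    by_cases hzS : z ∈ S
    · rw [indicator_of_mem hzS, hz hzS]
    · rw [indicator_of_notMem hzS, hps0 z hzS]
  -- the datum bound
  have hχ1abs : ∀ x, |χ x| ≤ 1 := fun x => by
    rw [abs_of_nonneg (hχnn _)]; exact hχle _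
  have hχball : ∀ x, x ∉ ball x₀ 1 → χ x = 0 := fun x hx => by
    refine hχzero _ fun h => hx ?_
    rw [mem_closedBall, dist_zero_right] at h
    rw [mem_ball, dist_eq_norm]; linarith
  have hM0 : 0 ≤ (M : ℝ) := M.coe_nonneg
  have hu₀b : ∀ x, ‖φ 0 x • u₀ x‖ ≤ M := fun x => by
    rw [hφ0]; exact norm_cutoff_smul_le hM0 hM hχ1abs hχball x
  /- ## the representation of the three components -/
  have repr := fun k : Fin 3 =>
    duhamel_representation_datum (p := fun t x => p t x - cg t) hus hus0 husi hus2 hps hps0 hpsi hweak hm₀ hφT hu₀b (b k)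
  
  /- ## the box carrying the truncated data -/
  set E : Set (ℝ × EuclideanSpace ℝ (Fin 3)) := Icc (0 : ℝ) 1 ×ˢ closedBall x₀ 1 with hE
  have hEm : MeasurableSet E := measurableSet_Icc.prod measurableSet_closedBall
  have hvolE : volume E = volume (Icc (0 : ℝ) 1 ×ˢ closedBall (0 : EuclideanSpace ℝ (Fin 3)) 1) := by
    rw [hE, Measure.volume_eq_prod, Measure.prod_prod, Measure.prod_prod, Measure.addHaar_closedBall_center]
  have hEfin : volume E ≠ ⊤ := by
    rw [hvolE]; exact ((isCompact_Icc.prod (isCompact_closedBall _ _)).measure_lt_top).ne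
  have hvolEr : (volume E).toReal = VE := by rw [hvolE]
  have hd₁0 : 0 < d₁ := by rw [hd₁]; linarith
  have hd₁5 : d₁ ≤ 5 := by rw [hd₁]; linarith
  have hd₂0 : 0 < d₂ := by rw [hd₂]; linarith
  have hd₂5 : d₂ ≤ 5 := by rw [hd₂]; linarith
  have hd₁3 : 3 < d₁ := by rw [hd₁]; linarith
  have hd₁4 : d₁ < 4 := by rw [hd₁]; linarith
  have hd₂4 : 4 < d₂ := by rw [hd₂]; linarith
  have hd₂5' : d₂ < 5 := by rw [hd₂]; linarith
  have hd₁γ : d₁ - 3 = γ := by rw [hd₁]; ring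
  have hd₂γ : d₂ - 4 = γ := by rw [hd₂]; ring
  have hcb725 : closedBall x₀ (7 / 25) ⊆ ball x₀ (7 / 24) := closedBall_subset_ball (by norm_num)
  have hcb_of : ∀ y : EuclideanSpace ℝ (Fin 3), y - x₀ ∈ closedBall (0 : EuclideanSpace ℝ (Fin 3)) (7 / 25) ↔ y ∈ closedBall x₀ (7 / 25) := fun y => by
    rw [mem_closedBall, mem_closedBall, dist_zero_right, dist_eq_norm]
  /- ## generic Morrey bound for bounded truncated data -/
  have GEN : ∀ (D : ℝ × EuclideanSpace ℝ (Fin 3) → ℝ) (N : ℝ), 0 ≤ N → Measurable D →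
      (∀ w, w ∉ S → D w = 0) → (∀ w : ℝ × EuclideanSpace ℝ (Fin 3), w.2 ∉ closedBall x₀ (7 / 25) → D w = 0) →
      (∀ᵐ w ∂(volume : Measure (ℝ × EuclideanSpace ℝ (Fin 3))), w ∈ S → w.2 ∈ ball x₀ (7 / 12) → ‖D w‖ ≤ N) →
      Measurable (fun w : ℝ × EuclideanSpace ℝ (Fin 3) => if w.1 < Tb then D w else 0) ∧
      (∀ w : ℝ × EuclideanSpace ℝ (Fin 3), w.1 ≤ 0 → (if w.1 < Tb then D w else 0) = 0) ∧
      (∀ {d : ℝ}, 0 < d → d ≤ 5 → ∀ (c : ℝ × EuclideanSpace ℝ (Fin 3)) (r : ℝ), 0 < r →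
        ∫⁻ w in FluidPDE.parabolicCylinderCentered r c, ‖(if w.1 < Tb then D w else 0)‖ₑ ≤
          ENNReal.ofReal (Bof N * r ^ d)) := by
    intro D N hN hDm hDS hDx hDb
    have hm : Measurable (fun w : ℝ × EuclideanSpace ℝ (Fin 3) => if w.1 < Tb then D w else 0) :=
      Measurable.ite (measurableSet_lt measurable_fst measurable_const) hDm measurable_const
    have hz0 : ∀ w : ℝ × EuclideanSpace ℝ (Fin 3), w.1 ≤ 0 → (if w.1 < Tb then D w else 0) = 0 := by
      intro w hw
      have : w ∉ S := fun h => absurd h.1.1 (not_lt.2 hw)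
      simp only [hDS w this, ite_self]
    refine ⟨hm, hz0, ?_⟩
    intro d hd0 hd5 c r hr
    have hfN : ∀ᵐ w ∂(volume : Measure (ℝ × EuclideanSpace ℝ (Fin 3))), ‖(if w.1 < Tb then D w else 0)‖ ≤ N := by
      filter_upwards [hDb] with w hw
      by_cases h1 : w.1 < Tb
      · rw [if_pos h1]
        by_cases h2 : w ∈ S
        · by_cases h3 : w.2 ∈ closedBall x₀ (7 / 25)
          · exact hw h2 (ball_subset_ball (by norm_num) (hcb725 h3))
          · rw [hDx w h3, norm_zero]; exact hN
        · rw [hDS w h2, norm_zero]; exact hN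
      · rw [if_neg h1, norm_zero]; exact hN
    have hfE : ∀ᵐ w ∂(volume : Measure (ℝ × EuclideanSpace ℝ (Fin 3))), w ∉ E → (if w.1 < Tb then D w else 0) = 0 := by
      refine Eventually.of_forall fun w hw => ?_
      by_cases h1 : w.1 < Tb
      · rw [if_pos h1]
        by_cases h2 : w ∈ S
        · by_cases h3 : w.2 ∈ closedBall x₀ (7 / 25)
          · exact absurd (show w ∈ E from ⟨⟨h2.1.1.le, by linarith⟩, closedBall_subset_closedBall (by norm_num) h3⟩) hw
          · exact hDx w h3
        · exact hDS w h2
      · rw [if_neg h1]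
    have h := morreyOne_of_bound hN hfN hEm hEfin hfE hd0 hd5 c hr
    rw [hvolEr] at h
    exact h
  /- ## generic Morrey bound for near-field pressure data -/
  -- the slice bound of the modified near field
  have hnear_slice : ∀ᵐ t ∂(volume.restrict (Ioo 0 Tb)), eLpNorm (fun x => nearM (t, x)) q volume ≤ Pn := by
    -- a.e. slices: `nearM(t,·) = near(t,·)` a.e., `u(t)` measurable, `|u(t)| ≤ K_b` a.e. on the big ball
    have h1 : ∀ᵐ t ∂(volume.restrict (Ioo 0 T')), ∀ᵐ x ∂(volume : Measure (EuclideanSpace ℝ (Fin 3))),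
        localPressureNear x₀ (7 / 24) u t x = nearM (t, x) := by
      have h := (ae_restrict_iff' hS'm).2 hnearae
      have h' := SerrinBoundedHolder.ae_ae_of_ae_restrict_prod (I := Ioo 0 T') (B := (univ : Set (EuclideanSpace ℝ (Fin 3)))) (P := fun z =>
        localPressureNear x₀ (7 / 24) u z.1 z.2 = nearM z) (h.mono fun z hz => hz)
      simpa only [Measure.restrict_univ] using h'
    have h2 := hu.ae_aestronglyMeasurable_slice'
    have h3 : ∀ᵐ t ∂(volume.restrict (Ioo 0 Tb')), ∀ᵐ x ∂(volume : Measure (EuclideanSpace ℝ (Fin 3))),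
        x ∈ ball x₀ (7 / 12) → ‖u t x‖ ≤ Kb := by
      have h := SerrinBoundedHolder.ae_ae_of_ae_restrict_prod hbd
      filter_upwards [h] with t ht
      exact (ae_restrict_iff' measurableSet_ball).1 ht
    have h1' := ae_restrict_of_ae_restrict_of_subset (Ioo_subset_Ioo_right ((hTbTb'.le).trans hTb'T')) h1
    have h2' := ae_restrict_of_ae_restrict_of_subset (Ioo_subset_Ioo_right ((hTbTb'.le).trans hTb'T')) h2
    have h3' := ae_restrict_of_ae_restrict_of_subset (Ioo_subset_Ioo_right hTbTb'.le) h3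
    filter_upwards [h1', h2', h3'] with t ht1 ht2 ht3
    have hb' : ∀ᵐ x ∂(volume : Measure (EuclideanSpace ℝ (Fin 3))), x ∈ ball x₀ (2 * (7 / 24)) → ‖u t x‖ ≤ Kb := by
      rw [show (2 : ℝ) * (7 / 24) = 7 / 12 by norm_num]; exact ht3
    have h := hCq hKb ht2 hb'
    rw [show (2 : ℝ) * (7 / 24) = 7 / 12 by norm_num, Measure.addHaar_ball_center] at h
    calc eLpNorm (fun x => nearM (t, x)) q volume = eLpNorm (localPressureNear x₀ (7 / 24) u t) q volume :=
          (eLpNorm_congr_ae (ht1.mono fun x hx => hx.symm))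
      _ ≤ _ := h
  have GENP : ∀ (coef : ℝ × EuclideanSpace ℝ (Fin 3) → ℝ) (Cc : ℝ), 0 ≤ Cc → Measurable coef →
      (∀ w, ‖coef w‖ ≤ Cc) → (∀ w : ℝ × EuclideanSpace ℝ (Fin 3), w.2 ∉ closedBall x₀ (7 / 25) → coef w = 0) →
      Measurable (fun w : ℝ × EuclideanSpace ℝ (Fin 3) => if w.1 < Tb then coef w * S.indicator nearM w else 0) ∧
      (∀ w : ℝ × EuclideanSpace ℝ (Fin 3), w.1 ≤ 0 → (if w.1 < Tb then coef w * S.indicator nearM w else 0) = 0) ∧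
      (∀ {d : ℝ}, 0 < d → d ≤ 5 - 3 / q.toReal → ∀ (c : ℝ × EuclideanSpace ℝ (Fin 3)) (r : ℝ), 0 < r →
        ∫⁻ w in FluidPDE.parabolicCylinderCentered r c, ‖(if w.1 < Tb then coef w * S.indicator nearM w else 0)‖ₑ ≤
          ENNReal.ofReal (BLq ((ENNReal.ofReal Cc * Pn).toReal) * r ^ d)) := by
    intro coef Cc hCc hcm hcb hcx
    set D' : ℝ × EuclideanSpace ℝ (Fin 3) → ℝ := fun w => if w.1 < Tb then coef w * S.indicator nearM w else 0 with hD'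
    have hm : Measurable D' :=
      Measurable.ite (measurableSet_lt measurable_fst measurable_const) (hcm.mul (hnearMm.indicator hSm)) measurable_const
    have hDS : ∀ z : ℝ × EuclideanSpace ℝ (Fin 3), z.1 ∉ Ioo 0 Tb → D' z = 0 := by
      intro z hz
      by_cases h1 : z.1 < Tb
      · have hzS : z ∉ S := fun h => hz ⟨h.1.1, h1⟩
        simp only [hD', h1, if_true, indicator_of_notMem hzS, mul_zero]
      · simp only [hD', h1, if_false]
    have hz0 : ∀ w : ℝ × EuclideanSpace ℝ (Fin 3), w.1 ≤ 0 → D' w = 0 := fun w hw =>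
      hDS w fun h => absurd h.1 (not_lt.2 hw)
    refine ⟨hm, hz0, ?_⟩
    intro d hd0 hd c r hr
    have hDρ : ∀ z : ℝ × EuclideanSpace ℝ (Fin 3), z.2 ∉ ball x₀ (7 / 24) → D' z = 0 := by
      intro z hz
      have : coef z = 0 := hcx z fun h => hz (hcb725 h)
      simp only [hD', this, zero_mul, ite_self]
    have hDm' : ∀ t, AEStronglyMeasurable (fun x => D' (t, x)) volume := fun t =>
      (hm.comp measurable_prodMk_left).aestronglyMeasurable
    have hPt : ENNReal.ofReal Cc * Pn ≠ ⊤ := ENNReal.mul_ne_top ENNReal.ofReal_ne_top hPnt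
    have hslice : ∀ᵐ t ∂(volume.restrict (Ioo 0 Tb)), eLpNorm (fun x => D' (t, x)) q volume ≤ ENNReal.ofReal Cc * Pn := by
      filter_upwards [hnear_slice, ae_restrict_mem measurableSet_Ioo] with t ht htI
      have hform : ∀ x, D' (t, x) = coef (t, x) * nearM (t, x) := fun x => by
        have hzS : ((t, x) : ℝ × EuclideanSpace ℝ (Fin 3)) ∈ S := ⟨⟨htI.1, htI.2.trans hTbTb'⟩, mem_univ _⟩
        simp only [hD', htI.2, if_true, indicator_of_mem hzS]
      simp_rw [hform]
      have hle : ∀ᵐ x ∂(volume : Measure (EuclideanSpace ℝ (Fin 3))), ‖coef (t, x) * nearM (t, x)‖ ≤ Cc * ‖nearM (t, x)‖ :=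
        Eventually.of_forall fun x => by rw [norm_mul]; exact mul_le_mul_of_nonneg_right (hcb _) (norm_nonneg _)
      exact (eLpNorm_le_mul_eLpNorm_of_ae_le_mul hle q).trans (mul_le_mul' le_rfl ht)
    have h := morreyOne_of_Lq_slices (f := D') hTb hDS hDρ hDm' hq1.le hqt.ne hPt hslice hd0 hd c hr
    refine h.trans (ENNReal.ofReal_le_ofReal ?_)
    have hvb : (volume (ball x₀ (7 / 24 : ℝ))).toReal = Vρ := by rw [hVρ, Measure.addHaar_ball_center]
    rw [hvb, show (volume (ball (0 : EuclideanSpace ℝ (Fin 3)) 1)).toReal = V₁ from rfl,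
      show (1 - 1 / q.toReal) = e from rfl]
    have hP0 : 0 ≤ (ENNReal.ofReal Cc * Pn).toReal := ENNReal.toReal_nonneg
    have hrd : 0 ≤ r ^ d := Real.rpow_nonneg hr.le _
    have hV : 0 ≤ Vρ ^ e := Real.rpow_nonneg hVρ0 _
    have hmono : Tb * (ENNReal.ofReal Cc * Pn).toReal * Vρ ^ e ≤ (ENNReal.ofReal Cc * Pn).toReal * Vρ ^ e := by
      calc Tb * (ENNReal.ofReal Cc * Pn).toReal * Vρ ^ e = Tb * ((ENNReal.ofReal Cc * Pn).toReal * Vρ ^ e) := by ring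
        _ ≤ 1 * ((ENNReal.ofReal Cc * Pn).toReal * Vρ ^ e) := mul_le_mul_of_nonneg_right hTb1 (mul_nonneg hP0 hV)
        _ = _ := one_mul _
    simp only [hBLq]
    exact mul_le_mul_of_nonneg_right (add_le_add le_rfl hmono) hrd
  /- ## the far-field pressure bound, a.e. in space–time -/
  have hfar_ae : ∀ᵐ w ∂(volume : Measure (ℝ × EuclideanSpace ℝ (Fin 3))),
      w ∈ S' → w.2 ∈ ball x₀ (7 / 24) → ‖farM w‖ ≤ Fb := by
    -- in time only
    have ht : ∀ᵐ t ∂(volume : Measure ℝ), t ∈ Ioo 0 T' → AEStronglyMeasurable (u t) volume ∧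
        ∀ z : EuclideanSpace ℝ (Fin 3), ∫⁻ x in ball z 1, ‖u t x‖ₑ ^ 2 ≤ αu := by
      have h := hu.ae_aestronglyMeasurable_slice'
      rw [← ae_restrict_iff' measurableSet_Ioo]
      filter_upwards [h, hαu] with t h1 h2
      exact ⟨h1, h2⟩
    have hprod : ∀ᵐ w ∂(volume : Measure (ℝ × EuclideanSpace ℝ (Fin 3))), w.1 ∈ Ioo 0 T' →
        AEStronglyMeasurable (u w.1) volume ∧ ∀ z : EuclideanSpace ℝ (Fin 3), ∫⁻ x in ball z 1, ‖u w.1 x‖ₑ ^ 2 ≤ αu := by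
      have hq : Measure.QuasiMeasurePreserving (Prod.fst : ℝ × EuclideanSpace ℝ (Fin 3) → ℝ) volume volume := by
        rw [Measure.volume_eq_prod]; exact Measure.quasiMeasurePreserving_fst
      exact hq.ae ht
    filter_upwards [hprod, hfarae] with w hw hwf hwS' hwB
    obtain ⟨hm, hα⟩ := hw hwS'.1
    rw [← hwf hwS']
    have h := hFfar hm hα w.2 hwB
    rw [← ofReal_norm] at h
    exact (ENNReal.ofReal_le_iff_le_toReal hFbt).1 h
  /- ## the components -/
  have hχcont : Continuous χ := hχs.continuous.comp (continuous_id.sub continuous_const)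
  have hu₀cont : ContinuousOn u₀ (ball x₀ 2) := hH.continuousOn hγ0
  have hHdist : ∀ x ∈ ball x₀ 2, ∀ y ∈ ball x₀ 2, ‖u₀ x - u₀ y‖ ≤ M * ‖x - y‖ ^ (γ : ℝ) := by
    intro x hx y hy
    have h := hH.dist_le hx hy
    rwa [dist_eq_norm, dist_eq_norm] at h
  have hχLip' : ∀ x y, |χ x - χ y| ≤ Dχ * ‖x - y‖ := fun x y => by
    have h := hχLip (x - x₀) (y - x₀)
    rwa [show x - x₀ - (y - x₀) = x - y by abel] at h
  have hcutH : ∀ y z, ‖χ y • u₀ y - χ z • u₀ z‖ ≤ M * (1 + 4 * Dχ) * ‖y - z‖ ^ (γ : ℝ) :=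
    holder_cutoff_smul hM0 hD0 hγ0 hγ1.le hM hHdist hχ1abs hχLip' hχball
  -- coefficients
  set cL : ℝ × EuclideanSpace ℝ (Fin 3) → ℝ := fun w => (Δ χ₀) (w.2 - x₀) with hcL
  set cD : Fin 3 → ℝ × EuclideanSpace ℝ (Fin 3) → ℝ := fun i w => fderiv ℝ χ₀ (w.2 - x₀) (b i) with hcD
  set c0 : ℝ × EuclideanSpace ℝ (Fin 3) → ℝ := fun w => χ₀ (w.2 - x₀) with hc0
  have hcLm : Measurable cL := (continuous_laplacian hχ2).measurable.comp (measurable_snd.sub measurable_const)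
  have hcDm : ∀ i, Measurable (cD i) := fun i =>
    ((hχs.continuous_fderiv (by simp)).clm_apply continuous_const).measurable.comp (measurable_snd.sub measurable_const)
  have hc0m : Measurable c0 := hχs.continuous.measurable.comp (measurable_snd.sub measurable_const)
  have hcLb : ∀ w, ‖cL w‖ ≤ Lχ := fun w => by rw [Real.norm_eq_abs]; exact hχL _
  have hcDb : ∀ i w, ‖cD i w‖ ≤ Dχ := fun i w => by
    simp only [hcD]
    calc ‖fderiv ℝ χ₀ (w.2 - x₀) (b i)‖ ≤ ‖fderiv ℝ χ₀ (w.2 - x₀)‖ * ‖b i‖ := ContinuousLinearMap.le_opNorm _ _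
      _ ≤ Dχ * 1 := mul_le_mul (hχD _) (hb1 i).le (norm_nonneg _) hD0
      _ = Dχ := mul_one _
  have hc0b : ∀ w, ‖c0 w‖ ≤ 1 := fun w => by rw [Real.norm_eq_abs, hc0, abs_of_nonneg (hχnn _)]; exact hχle _
  have hcLx : ∀ w : ℝ × EuclideanSpace ℝ (Fin 3), w.2 ∉ closedBall x₀ (7 / 25) → cL w = 0 := fun w hw =>
    hχLzero _ fun h => hw ((hcb_of w.2).1 h)
  have hcDx : ∀ i (w : ℝ × EuclideanSpace ℝ (Fin 3)), w.2 ∉ closedBall x₀ (7 / 25) → cD i w = 0 := fun i w hw => by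
    show fderiv ℝ χ₀ (w.2 - x₀) (b i) = 0
    rw [hχfzero _ fun h => hw ((hcb_of w.2).1 h)]; rfl
  have hc0x : ∀ w : ℝ × EuclideanSpace ℝ (Fin 3), w.2 ∉ closedBall x₀ (7 / 25) → c0 w = 0 := fun w hw =>
    hχzero _ fun h => hw ((hcb_of w.2).1 h)
  -- the monomials of `us`
  have hmon1 : ∀ k, ∀ᵐ w ∂(volume : Measure (ℝ × EuclideanSpace ℝ (Fin 3))), w ∈ S → w.2 ∈ ball x₀ (7 / 12) →
      ‖(⟪us w, b k⟫ : ℝ)‖ ≤ Kb := fun k => by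
    filter_upwards [husb] with w hw hwS hwB
    exact (norm_inner_le_norm _ _).trans (by rw [hb1, mul_one]; exact hw hwS hwB)
  have hmon2 : ∀ i k, ∀ᵐ w ∂(volume : Measure (ℝ × EuclideanSpace ℝ (Fin 3))), w ∈ S → w.2 ∈ ball x₀ (7 / 12) →
      ‖(⟪us w, b i⟫ : ℝ) * ⟪us w, b k⟫‖ ≤ Kb ^ 2 := fun i k => by
    filter_upwards [husb] with w hw hwS hwB
    rw [norm_mul]
    have h1 : ‖(⟪us w, b i⟫ : ℝ)‖ ≤ Kb := (norm_inner_le_norm _ _).trans (by rw [hb1, mul_one]; exact hw hwS hwB)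
    have h2 : ‖(⟪us w, b k⟫ : ℝ)‖ ≤ Kb := (norm_inner_le_norm _ _).trans (by rw [hb1, mul_one]; exact hw hwS hwB)
    calc ‖(⟪us w, b i⟫ : ℝ)‖ * ‖(⟪us w, b k⟫ : ℝ)‖ ≤ Kb * Kb := mul_le_mul h1 h2 (norm_nonneg _) hKb
      _ = Kb ^ 2 := by ring
  have husme : ∀ a : EuclideanSpace ℝ (Fin 3), Measurable fun w => (⟪us w, a⟫ : ℝ) := fun a =>
    husm.inner measurable_const
  simp only [← hb_def] at repr
  have comp : ∀ k : Fin 3, ∃ Uk : ℝ × EuclideanSpace ℝ (Fin 3) → ℝ,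
      ParabolicHolderOnWith (Ck k) γ Uk (Ici (0 : ℝ) ×ˢ (univ : Set (EuclideanSpace ℝ (Fin 3)))) ∧
      (∀ᵐ z ∂(volume.restrict S), 0 < z.1 → z.1 ≤ Tb → z.2 ∈ closedBall x₀ (13 / 50) → (⟪u z.1 z.2, b k⟫ : ℝ) = Uk z) ∧
      (∀ x, Uk (0, x) = χ x * ⟪u₀ x, b k⟫) := by
    intro k
    -- ### the truncated data and their Morrey bounds
    obtain ⟨m1, z1, M1⟩ := GEN (fun w => cL w * ⟪us w, b k⟫) (Lχ * Kb) (by positivity) (hcLm.mul (husme _))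
      (fun w hw => by simp only [hus0 w hw, inner_zero_left, mul_zero]) (fun w hw => by simp only [hcLx w hw, zero_mul])
      (by filter_upwards [hmon1 k] with w hw hwS hwB; rw [norm_mul]; exact mul_le_mul (hcLb w) (hw hwS hwB) (norm_nonneg _) hL0)
    have GEN2 := fun i => GEN (fun w => (2 * cD i w) * ⟪us w, b k⟫) (2 * Dχ * Kb) (by positivity)
      ((measurable_const.mul (hcDm i)).mul (husme _))
      (fun w hw => by simp only [hus0 w hw, inner_zero_left, mul_zero]) (fun w hw => by simp only [hcDx i w hw, mul_zero, zero_mul])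
      (by filter_upwards [hmon1 k] with w hw hwS hwB
          rw [norm_mul, norm_mul, Real.norm_eq_abs, abs_of_pos two_pos]
          calc 2 * ‖cD i w‖ * ‖(⟪us w, b k⟫ : ℝ)‖ ≤ 2 * Dχ * Kb := by
                gcongr
                · exact hcDb i w
                · exact hw hwS hwB)
    have GEN3 := fun i => GEN (fun w => cD i w * (⟪us w, b i⟫ * ⟪us w, b k⟫)) (Dχ * Kb ^ 2) (by positivity)
      ((hcDm i).mul ((husme _).mul (husme _)))
      (fun w hw => by simp only [hus0 w hw, inner_zero_left, mul_zero]) (fun w hw => by simp only [hcDx i w hw, zero_mul])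
      (by filter_upwards [hmon2 i k] with w hw hwS hwB; rw [norm_mul]; exact mul_le_mul (hcDb i w) (hw hwS hwB) (norm_nonneg _) hD0)
    have GEN4 := fun i => GEN (fun w => c0 w * (⟪us w, b i⟫ * ⟪us w, b k⟫)) (Kb ^ 2) (by positivity)
      (hc0m.mul ((husme _).mul (husme _)))
      (fun w hw => by simp only [hus0 w hw, inner_zero_left, mul_zero]) (fun w hw => by simp only [hc0x w hw, zero_mul])
      (by filter_upwards [hmon2 i k] with w hw hwS hwB; rw [norm_mul]
          calc ‖c0 w‖ * ‖(⟪us w, b i⟫ : ℝ) * ⟪us w, b k⟫‖ ≤ 1 * Kb ^ 2 := mul_le_mul (hc0b w) (hw hwS hwB) (norm_nonneg _) zero_le_one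
            _ = Kb ^ 2 := one_mul _)
    obtain ⟨m5n, z5n, M5n⟩ := GENP (cD k) Dχ hD0 (hcDm k) (hcDb k) (hcDx k)
    obtain ⟨m5f, z5f, M5f⟩ := GEN (fun w => cD k w * S.indicator farM w) (Dχ * Fb) (by positivity)
      ((hcDm k).mul (hfarMm.indicator hSm))
      (fun w hw => by simp only [indicator_of_notMem hw, mul_zero]) (fun w hw => by simp only [hcDx k w hw, zero_mul])
      (by filter_upwards [hfar_ae] with w hw hwS hwB
          rw [norm_mul, indicator_of_mem hwS]
          by_cases h3 : w.2 ∈ closedBall x₀ (7 / 25)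
          · exact mul_le_mul (hcDb k w) (hw (hSS' hwS) (hcb725 h3)) (norm_nonneg _) hD0
          · rw [hcDx k w h3, norm_zero, zero_mul]; positivity)
    obtain ⟨m6n, z6n, M6n⟩ := GENP c0 1 zero_le_one hc0m hc0b hc0x
    obtain ⟨m6f, z6f, M6f⟩ := GEN (fun w => c0 w * S.indicator farM w) Fb hFb0
      (hc0m.mul (hfarMm.indicator hSm))
      (fun w hw => by simp only [indicator_of_notMem hw, mul_zero]) (fun w hw => by simp only [hc0x w hw, zero_mul])
      (by filter_upwards [hfar_ae] with w hw hwS hwB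
          rw [norm_mul, indicator_of_mem hwS]
          by_cases h3 : w.2 ∈ closedBall x₀ (7 / 25)
          · calc ‖c0 w‖ * ‖farM w‖ ≤ 1 * Fb := mul_le_mul (hc0b w) (hw (hSS' hwS) (hcb725 h3)) (norm_nonneg _) zero_le_one
              _ = Fb := one_mul _
          · rw [hc0x w h3, norm_zero, zero_mul]; exact hFb0)
    -- the data
    set D1 : ℝ × EuclideanSpace ℝ (Fin 3) → ℝ := fun w => if w.1 < Tb then cL w * ⟪us w, b k⟫ else 0 with hD1
    set D2 : Fin 3 → ℝ × EuclideanSpace ℝ (Fin 3) → ℝ := fun i w => if w.1 < Tb then (2 * cD i w) * ⟪us w, b k⟫ else 0 with hD2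
    set D3 : Fin 3 → ℝ × EuclideanSpace ℝ (Fin 3) → ℝ := fun i w => if w.1 < Tb then cD i w * (⟪us w, b i⟫ * ⟪us w, b k⟫) else 0 with hD3
    set D4 : Fin 3 → ℝ × EuclideanSpace ℝ (Fin 3) → ℝ := fun i w => if w.1 < Tb then c0 w * (⟪us w, b i⟫ * ⟪us w, b k⟫) else 0 with hD4
    set D5 : ℝ × EuclideanSpace ℝ (Fin 3) → ℝ := fun w =>
      (if w.1 < Tb then cD k w * S.indicator nearM w else 0) + (if w.1 < Tb then cD k w * S.indicator farM w else 0) with hD5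
    set D6 : ℝ × EuclideanSpace ℝ (Fin 3) → ℝ := fun w =>
      (if w.1 < Tb then c0 w * S.indicator nearM w else 0) + (if w.1 < Tb then c0 w * S.indicator farM w else 0) with hD6
    have hqcond₁ : d₁ ≤ 5 - 3 / q.toReal := by
      rw [hd₁, hq_real, hqr]
      have h1 : 3 / (3 / (1 - (γ : ℝ)) + 2) ≤ 3 / (3 / (1 - (γ : ℝ))) :=
        div_le_div_of_nonneg_left (by norm_num) (by positivity) (by linarith)
      have h2 : 3 / (3 / (1 - (γ : ℝ))) = 1 - γ := by field_simp
      linarith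
    have hqcond₂ : d₂ ≤ 5 - 3 / q.toReal := by
      rw [hd₂, hq_real, hqr]
      have h1 : 3 / (3 / (1 - (γ : ℝ)) + 2) ≤ 3 / (3 / (1 - (γ : ℝ))) :=
        div_le_div_of_nonneg_left (by norm_num) (by positivity) (by linarith)
      have h2 : 3 / (3 / (1 - (γ : ℝ))) = 1 - γ := by field_simp
      linarith
    have m5 : Measurable D5 := m5n.add m5f
    have m6 : Measurable D6 := m6n.add m6f
    have z5 : ∀ w : ℝ × EuclideanSpace ℝ (Fin 3), w.1 ≤ 0 → D5 w = 0 := fun w hw => by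
      simp only [hD5, z5n w hw, z5f w hw, add_zero]
    have z6 : ∀ w : ℝ × EuclideanSpace ℝ (Fin 3), w.1 ≤ 0 → D6 w = 0 := fun w hw => by
      simp only [hD6, z6n w hw, z6f w hw, add_zero]
    have M5 : ∀ (c : ℝ × EuclideanSpace ℝ (Fin 3)) (r : ℝ), 0 < r →
        ∫⁻ w in FluidPDE.parabolicCylinderCentered r c, ‖D5 w‖ₑ ≤ ENNReal.ofReal (B₅ * r ^ d₁) := fun c r hr =>
      morreyOne_add (hBLq0 ENNReal.toReal_nonneg) (hBof0 (by positivity)) m5n.aemeasurable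
        (fun c r hr => M5n hd₁0 hqcond₁ c r hr) (fun c r hr => M5f hd₁0 hd₁5 c r hr) c hr
    have M6 : ∀ (c : ℝ × EuclideanSpace ℝ (Fin 3)) (r : ℝ), 0 < r →
        ∫⁻ w in FluidPDE.parabolicCylinderCentered r c, ‖D6 w‖ₑ ≤ ENNReal.ofReal (B₆ * r ^ d₂) := fun c r hr => by
      have h := morreyOne_add (hBLq0 ENNReal.toReal_nonneg) (hBof0 hFb0) m6n.aemeasurable
        (fun c r hr => M6n hd₂0 hqcond₂ c r hr) (fun c r hr => M6f hd₂0 hd₂5 c r hr) c hr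
      rwa [ENNReal.ofReal_one, one_mul] at h
    -- ### the Hölder continuity of the seven kinds of terms
    set SS : Set (ℝ × EuclideanSpace ℝ (Fin 3)) := Ici (0 : ℝ) ×ˢ (univ : Set (EuclideanSpace ℝ (Fin 3))) with hSS
    have T1 : ParabolicHolderOnWith H₁ γ (fun z => heatPotential 1 D1 z) SS := by
      have h := heatPotential_holder_of_morreyOne m1 hB₁0 hd₁3 hd₁4 z1 (fun c r hr => M1 hd₁0 hd₁5 c r hr)
      rw [hd₁γ] at h
      exact (h.mono (subset_univ _)).mono_const (le_abs_self _)
    have T2 : ∀ i, ParabolicHolderOnWith (H₂ i) γ (fun z => -(multiplierHeatPotential 1 (derivSymbol (b i)) (D2 i) z).re) SS := by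
      intro i
      obtain ⟨m2, z2, M2⟩ := GEN2 i
      have h := hAg i m2 hB₂0 hd₂4 hd₂5' z2 (fun c r hr => M2 hd₂0 hd₂5 c r hr)
      rw [hd₂γ] at h
      exact (h.mono (subset_univ _)).mono_const (le_abs_self _)
    have T3 : ∀ i, ParabolicHolderOnWith H₃ γ (fun z => heatPotential 1 (D3 i) z) SS := by
      intro i
      obtain ⟨m3, z3, M3⟩ := GEN3 i
      have h := heatPotential_holder_of_morreyOne m3 hB₃0 hd₁3 hd₁4 z3 (fun c r hr => M3 hd₁0 hd₁5 c r hr)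
      rw [hd₁γ] at h
      exact (h.mono (subset_univ _)).mono_const (le_abs_self _)
    have T4 : ∀ i, ParabolicHolderOnWith (H₄ i) γ (fun z => -(multiplierHeatPotential 1 (derivSymbol (b i)) (D4 i) z).re) SS := by
      intro i
      obtain ⟨m4, z4, M4⟩ := GEN4 i
      have h := hAg i m4 hB₄0 hd₂4 hd₂5' z4 (fun c r hr => M4 hd₂0 hd₂5 c r hr)
      rw [hd₂γ] at h
      exact (h.mono (subset_univ _)).mono_const (le_abs_self _)
    have T5 : ParabolicHolderOnWith H₅ γ (fun z => heatPotential 1 D5 z) SS := by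
      have h := heatPotential_holder_of_morreyOne m5 hB₅0 hd₁3 hd₁4 z5 M5
      rw [hd₁γ] at h
      exact (h.mono (subset_univ _)).mono_const (le_abs_self _)
    have T6 : ParabolicHolderOnWith (H₆ k) γ (fun z => -(multiplierHeatPotential 1 (derivSymbol (b k)) D6 z).re) SS := by
      have h := hAg k m6 hB₆0 hd₂4 hd₂5' z6 M6
      rw [hd₂γ] at h
      exact (h.mono (subset_univ _)).mono_const (le_abs_self _)
    -- the caloric term
    set Gk : (EuclideanSpace ℝ (Fin 3)) → ℝ := fun y => φ 0 y * ⟪u₀ y, b k⟫ with hGk_def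
    have hGk : ∀ y, Gk y = ⟪χ y • u₀ y, b k⟫ := fun y => by
      simp only [hGk_def, hφ0, real_inner_smul_left]
    have hGkc : Continuous Gk := by
      have h0 : Continuous fun y : EuclideanSpace ℝ (Fin 3) => χ y • u₀ y := continuous_cutoff_smul hχcont hu₀cont hχball
      have h : Continuous fun y : EuclideanSpace ℝ (Fin 3) => (⟪χ y • u₀ y, b k⟫ : ℝ) := h0.inner continuous_const
      exact h.congr fun y => (hGk y).symm
    have hGkb : ∀ y, ‖Gk y‖ ≤ M := fun y => by
      rw [hGk]
      exact (norm_inner_le_norm _ _).trans (by rw [hb1, mul_one]; exact norm_cutoff_smul_le hM0 hM hχ1abs hχball y)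
    have hGkH : ∀ y z, ‖Gk y - Gk z‖ ≤ M * (1 + 4 * Dχ) * ‖y - z‖ ^ (γ : ℝ) := fun y z => by
      rw [hGk, hGk, ← inner_sub_left]
      exact (norm_inner_le_norm _ _).trans (by rw [hb1, mul_one]; exact hcutH y z)
    have T7 : ParabolicHolderOnWith H₇ γ (fun z : ℝ × EuclideanSpace ℝ (Fin 3) =>
        if 0 < z.1 then heatExtension Gk z.1 z.2 else Gk z.2) SS :=
      caloric_parabolicHolderOnWith hGkc hGkb (by positivity) hγ0.le hγ1.le hGkH
    -- ### the representative of the component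
    set Uk : ℝ × EuclideanSpace ℝ (Fin 3) → ℝ := fun z =>
      heatPotential 1 D1 z + ∑ i, (-(multiplierHeatPotential 1 (derivSymbol (b i)) (D2 i) z).re)
        + ∑ i, heatPotential 1 (D3 i) z + ∑ i, (-(multiplierHeatPotential 1 (derivSymbol (b i)) (D4 i) z).re)
        + heatPotential 1 D5 z + (-(multiplierHeatPotential 1 (derivSymbol (b k)) D6 z).re)
        + (if 0 < z.1 then heatExtension Gk z.1 z.2 else Gk z.2) with hUk
    refine ⟨Uk, ?_, ?_, ?_⟩
    · -- Hölder continuity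
      have T2s := ParabolicHolderOnWith.sum (s := Finset.univ) fun i _ => T2 i
      have T3s := ParabolicHolderOnWith.sum (s := Finset.univ) fun i _ => T3 i
      have T4s := ParabolicHolderOnWith.sum (s := Finset.univ) fun i _ => T4 i
      have h := (((((T1.add T2s).add T3s).add T4s).add T5).add T6).add T7
      exact h
    · -- the identity on `(0,T_b] × B̄(x₀, 13/50)`
      filter_upwards [repr k, ae_restrict_mem hSm] with z hz hzS hz0 hzT hzx
      have hφz : φ z.1 z.2 = 1 := hφ1 z.1 z.2 hz0.le hzT hzx
      rw [hφz, one_mul] at hz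
      rw [hz]
      -- agreement of the data below `T_b`
      have hζw : ∀ w : ℝ × EuclideanSpace ℝ (Fin 3), w ∈ S → w.1 < Tb → ζ w.1 = 1 := fun w hw hwT =>
        hζ1 w.1 hw.1.1.le (by linarith)
      have A1 : ∀ w : ℝ × EuclideanSpace ℝ (Fin 3), w.1 < Tb →
          (timeDeriv φ w.1 w.2 + (Δ (φ w.1)) w.2) * ⟪us w, b k⟫ = D1 w := by
        intro w hw
        simp only [hD1, hw, if_true]
        by_cases hwS : w ∈ S
        · rw [hφdt, hφΔ, hζd w.1 hwS.1.1.le hw.le, hζw w hwS hw]; simp only [hcL]; ring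
        · simp only [hus0 w hwS, inner_zero_left, mul_zero]
      have A2 : ∀ i (w : ℝ × EuclideanSpace ℝ (Fin 3)), w.1 < Tb →
          (2 * fderiv ℝ (φ w.1) w.2 (b i)) * ⟪us w, b k⟫ = D2 i w := by
        intro i w hw
        simp only [hD2, hw, if_true]
        by_cases hwS : w ∈ S
        · rw [hφfd, hζw w hwS hw]; simp only [hcD]; ring
        · simp only [hus0 w hwS, inner_zero_left, mul_zero]
      have A3 : ∀ i (w : ℝ × EuclideanSpace ℝ (Fin 3)), w.1 < Tb →
          fderiv ℝ (φ w.1) w.2 (b i) * (⟪us w, b i⟫ * ⟪us w, b k⟫) = D3 i w := by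
        intro i w hw
        simp only [hD3, hw, if_true]
        by_cases hwS : w ∈ S
        · rw [hφfd, hζw w hwS hw]; simp only [hcD]; ring
        · simp only [hus0 w hwS, inner_zero_left, mul_zero]
      have A4 : ∀ i (w : ℝ × EuclideanSpace ℝ (Fin 3)), w.1 < Tb →
          φ w.1 w.2 * (⟪us w, b i⟫ * ⟪us w, b k⟫) = D4 i w := by
        intro i w hw
        simp only [hD4, hw, if_true]
        by_cases hwS : w ∈ S
        · simp only [hφ, hζw w hwS hw, one_mul, hc0, hχdef]
        · simp only [hus0 w hwS, inner_zero_left, mul_zero]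
      have hpsw : ∀ w : ℝ × EuclideanSpace ℝ (Fin 3), w.2 ∈ closedBall x₀ (7 / 25) →
          ps w = S.indicator nearM w + S.indicator farM w := fun w hw => by
        simp only [hps_def, hcb725 hw, if_true, hpsB]
        by_cases hwS : w ∈ S
        · simp only [indicator_of_mem hwS]
        · simp only [indicator_of_notMem hwS, add_zero]
      have A5 : ∀ w : ℝ × EuclideanSpace ℝ (Fin 3), w.1 < Tb →
          fderiv ℝ (φ w.1) w.2 (b k) * ps w = D5 w := by
        intro w hw
        simp only [hD5, hw, if_true]
        by_cases hwx : w.2 ∈ closedBall x₀ (7 / 25)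
        · rw [hpsw w hwx, hφfd]
          by_cases hwS : w ∈ S
          · rw [hζw w hwS hw]; simp only [hcD]; ring
          · simp only [indicator_of_notMem hwS, mul_zero, add_zero]
        · have hfd0 : fderiv ℝ χ₀ (w.2 - x₀) (b k) = 0 := by
            rw [hχfzero _ fun h => hwx ((hcb_of w.2).1 h)]; rfl
          rw [hφfd]
          simp only [hcD, hfd0, mul_zero, zero_mul, add_zero]
      have A6 : ∀ w : ℝ × EuclideanSpace ℝ (Fin 3), w.1 < Tb → φ w.1 w.2 * ps w = D6 w := by
        intro w hw
        simp only [hD6, hw, if_true]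
        by_cases hwx : w.2 ∈ closedBall x₀ (7 / 25)
        · rw [hpsw w hwx]
          by_cases hwS : w ∈ S
          · simp only [hφ, hζw w hwS hw, one_mul, hc0, hχdef]; ring
          · simp only [indicator_of_notMem hwS, mul_zero, add_zero]
        · have : φ w.1 w.2 = 0 := by simp only [hφ, hχdef, hχzero _ fun h => hwx ((hcb_of w.2).1 h), mul_zero]
          simp only [this, zero_mul, hc0x w hwx, add_zero]
      have A2' : ∀ i, multiplierHeatPotential 1 (derivSymbol (b i))
          (fun w : ℝ × EuclideanSpace ℝ (Fin 3) => (2 * fderiv ℝ (φ w.1) w.2 (b i)) * ⟪us w, b k⟫) z =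
          multiplierHeatPotential 1 (derivSymbol (b i)) (D2 i) z := fun i => multiplierHeatPotential_congr_of_lt (A2 i) hzT
      have A3' : ∀ i, heatPotential 1 (fun w : ℝ × EuclideanSpace ℝ (Fin 3) =>
          fderiv ℝ (φ w.1) w.2 (b i) * (⟪us w, b i⟫ * ⟪us w, b k⟫)) z = heatPotential 1 (D3 i) z := fun i =>
        heatPotential_congr_of_lt (A3 i) hzT
      have A4' : ∀ i, multiplierHeatPotential 1 (derivSymbol (b i))
          (fun w : ℝ × EuclideanSpace ℝ (Fin 3) => φ w.1 w.2 * (⟪us w, b i⟫ * ⟪us w, b k⟫)) z =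
          multiplierHeatPotential 1 (derivSymbol (b i)) (D4 i) z := fun i => multiplierHeatPotential_congr_of_lt (A4 i) hzT
      simp only [hUk, hz0, if_true, ← hGk_def]
      rw [heatPotential_congr_of_lt A1 hzT, heatPotential_congr_of_lt A5 hzT, multiplierHeatPotential_congr_of_lt A6 hzT]
      simp only [A2', A3', A4']
    · -- the value at `t = 0`
      intro x
      have hz : ((0 : ℝ), x).1 ≤ (0 : ℝ) := le_rfl
      have P20 : ∀ i, multiplierHeatPotential 1 (derivSymbol (b i)) (D2 i) ((0 : ℝ), x) = 0 := fun i =>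
        multiplierHeatPotential_eq_zero_of_nonpos (GEN2 i).2.1 hz
      have P30 : ∀ i, heatPotential 1 (D3 i) ((0 : ℝ), x) = 0 := fun i =>
        heatPotential_eq_zero_of_nonpos (GEN3 i).2.1 hz
      have P40 : ∀ i, multiplierHeatPotential 1 (derivSymbol (b i)) (D4 i) ((0 : ℝ), x) = 0 := fun i =>
        multiplierHeatPotential_eq_zero_of_nonpos (GEN4 i).2.1 hz
      have P10 : heatPotential 1 D1 ((0 : ℝ), x) = 0 := heatPotential_eq_zero_of_nonpos z1 hz
      have P50 : heatPotential 1 D5 ((0 : ℝ), x) = 0 := heatPotential_eq_zero_of_nonpos z5 hz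
      have P60 : multiplierHeatPotential 1 (derivSymbol (b k)) D6 ((0 : ℝ), x) = 0 :=
        multiplierHeatPotential_eq_zero_of_nonpos z6 hz
      simp only [hUk, lt_irrefl, if_false, P10, P20, P30, P40, P50, P60, Complex.zero_re, neg_zero, add_zero, zero_add,
        Finset.sum_const_zero]
      simp only [hGk_def, hφ0]
  
  /- ## the representative -/
  choose Uk hUkH hUkid hUk0 using comp
  set U : ℝ → (EuclideanSpace ℝ (Fin 3)) → (EuclideanSpace ℝ (Fin 3)) := fun t x => ∑ k, Uk k (t, x) • b k with hU
  have hUcomp : ∀ (z : ℝ × EuclideanSpace ℝ (Fin 3)) (k : Fin 3), (uncurry U z) k = Uk k z := by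
    rintro ⟨t, x⟩ k
    show (∑ j, Uk j (t, x) • b j) k = Uk k (t, x)
    rw [hb_def]; exact sum_smul_basisFun_apply (fun j => Uk j (t, x)) k
  have hUH : ParabolicHolderOnWith CH γ (uncurry U) (Ici (0 : ℝ) ×ˢ (univ : Set (EuclideanSpace ℝ (Fin 3)))) := by
    refine ParabolicHolderOnWith.euclidean (ι := Fin 3) (Cs := Ck) fun k => ?_
    intro z₁ h₁ z₂ h₂
    show ‖(uncurry U z₁) k - (uncurry U z₂) k‖ ≤ Ck k * parabolicDist z₁ z₂ ^ (γ : ℝ)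
    rw [hUcomp, hUcomp]
    exact hUkH k z₁ h₁ z₂ h₂
  -- the value at `t = 0`
  have hcb14 : closedBall x₀ (1 / 4) ⊆ closedBall x₀ (13 / 50) := closedBall_subset_closedBall (by norm_num)
  have hχ14 : ∀ x ∈ closedBall x₀ (13 / 50), χ x = 1 := fun x hx =>
    hχone _ (by rw [mem_closedBall, dist_zero_right, ← dist_eq_norm]; exact hx)
  have hU0 : ∀ x ∈ closedBall x₀ (13 / 50), U 0 x = u₀ x := by
    intro x hx
    simp only [hU, hUk0, hχ14 x hx, one_mul]
    rw [hb_def]; exact (eq_sum_inner_smul_basisFun (u₀ x)).symm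
  refine ⟨U, ?_, fun x hx => hU0 x (hcb14 hx), ?_, ?_⟩
  · -- a.e. equality with `u`
    have hsub : Ioo 0 Tb ×ˢ ball x₀ (1 / 4) ⊆ S := Set.prod_mono (Ioo_subset_Ioo_right hTbTb'.le) (subset_univ _)
    have hall : ∀ᵐ z ∂(volume.restrict S), ∀ k, 0 < z.1 → z.1 ≤ Tb → z.2 ∈ closedBall x₀ (13 / 50) →
        (⟪u z.1 z.2, b k⟫ : ℝ) = Uk k z := ae_all_iff.2 hUkid
    filter_upwards [ae_restrict_of_ae_restrict_of_subset hsub hall,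
      ae_restrict_mem (measurableSet_Ioo.prod measurableSet_ball)] with z hz hzm
    have hzx : z.2 ∈ closedBall x₀ (13 / 50) := hcb14 (ball_subset_closedBall hzm.2)
    have hk : ∀ k, Uk k z = ⟪u z.1 z.2, b k⟫ := fun k => (hz k hzm.1.1 hzm.1.2.le hzx).symm
    show (∑ k, Uk k (z.1, z.2) • b k) = u z.1 z.2
    have e1 : (∑ k, Uk k (z.1, z.2) • b k) = ∑ k, (⟪u z.1 z.2, b k⟫ : ℝ) • b k :=
      Finset.sum_congr rfl fun k _ => by rw [Prod.mk.eta, hk k]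
    rw [e1, hb_def]; exact (eq_sum_inner_smul_basisFun (u z.1 z.2)).symm
  · -- the bound
    rintro ⟨t, x⟩ ⟨ht, hx⟩
    rw [mem_Icc] at ht
    have h0mem : ((0 : ℝ), x) ∈ Ici (0 : ℝ) ×ˢ (univ : Set (EuclideanSpace ℝ (Fin 3))) :=
      mem_prod.2 ⟨mem_Ici.2 le_rfl, mem_univ _⟩
    have htmem : ((t, x) : ℝ × EuclideanSpace ℝ (Fin 3)) ∈ Ici (0 : ℝ) ×ˢ (univ : Set (EuclideanSpace ℝ (Fin 3))) :=
      mem_prod.2 ⟨mem_Ici.2 ht.1, mem_univ _⟩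
    have h1 := hUH (t, x) htmem ((0 : ℝ), x) h0mem
    have hdist : parabolicDist ((t, x) : ℝ × EuclideanSpace ℝ (Fin 3)) ((0 : ℝ), x) ≤ 1 := by
      unfold parabolicDist
      simp only [sub_zero, sub_self, norm_zero, add_zero, abs_of_nonneg ht.1]
      rw [Real.sqrt_le_one]; linarith
    have hpow : parabolicDist ((t, x) : ℝ × EuclideanSpace ℝ (Fin 3)) ((0 : ℝ), x) ^ (γ : ℝ) ≤ 1 :=
      Real.rpow_le_one (parabolicDist_nonneg _ _) hdist hγ0.le
    have hval : uncurry U ((0 : ℝ), x) = u₀ x := hU0 x (hcb14 hx)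
    calc ‖uncurry U (t, x)‖ ≤ ‖uncurry U (t, x) - uncurry U ((0 : ℝ), x)‖ + ‖uncurry U ((0 : ℝ), x)‖ := norm_le_norm_sub_add _ _
      _ ≤ CH * parabolicDist ((t, x) : ℝ × EuclideanSpace ℝ (Fin 3)) ((0 : ℝ), x) ^ (γ : ℝ) + M := by
          refine add_le_add h1 ?_
          rw [hval]; exact hM x (closedBall_subset_ball (by norm_num) hx)
      _ ≤ CH * 1 + M := by gcongr
      _ = CH + M := by ring
  · -- parabolic Hölder continuity
    rw [isParabolicHolderOn_iff]
    exact (hUH.mono (Set.prod_mono Icc_subset_Ici_self (subset_univ _))).mono_const (by linarith)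

end JiaSverak2014

end Literature.Analysis.FluidPDE

end
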